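import Summits.Ventures.PercRepro.RankLevelSetLevelSixT16Cell7
import Summits.Ventures.PercRepro.RankLevelSetLevelSixT16Cell8
import Summits.Ventures.PercRepro.RankLevelSetLevelSixT16Cell9
import Summits.Ventures.PercRepro.RankLevelSetLevelSixT16Cell10
import Summits.Ventures.PercRepro.RankLevelSetLevelSixT16Cell11
import Summits.Ventures.PercRepro.RankLevelSetLevelSixT16Cell12
import Summits.Ventures.PercRepro.RankLevelSetLevelSixT16Cell13
import Summits.Ventures.PercRepro.RankLevelSetLevelSixT16Cell14
import Summits.Ventures.PercRepro.RankLevelSetLevelSixT16Cell15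
import Summits.Ventures.PercRepro.RankLevelSetLevelSixT16Cell16
import Summits.Ventures.PercRepro.RankLevelSetLevelSixT16Cell17
import Summits.Ventures.PercRepro.RankLevelSetLevelSixT16Cell18
import Summits.Ventures.PercRepro.RankLevelSetLevelSixT16Cell19
import Summits.Ventures.PercRepro.RankLevelSetLevelSixT16Cell20
import Summits.Ventures.PercRepro.RankLevelSetLevelSixT16Cell21
import Summits.Ventures.PercRepro.RankLevelSetLevelSixT16Cell22
import Summits.Ventures.PercRepro.RankLevelSetLevelSixT16Cell23
import Summits.Ventures.PercRepro.RankLevelSetLevelSixT16Cell24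
import Summits.Ventures.PercRepro.RankLevelSetLevelSixT16Cell25
import Summits.Ventures.PercRepro.RankLevelSetLevelSixT16Cell26
import Summits.Ventures.PercRepro.RankLevelSetLevelSixT16Cell27
import Summits.Ventures.PercRepro.RankLevelSetLevelSixT16Cell28
import Summits.Ventures.PercRepro.RankLevelSetLevelSixT16Cell29
import Summits.Ventures.PercRepro.RankLevelSetLevelSixT16Cell30
import Summits.Ventures.PercRepro.RankLevelSetLevelSixT16Cell31
import Summits.Ventures.PercRepro.RankLevelSetLevelSixT16Cell32
import Summits.Ventures.PercRepro.RankLevelSetLevelSixT16Cell33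
import Summits.Ventures.PercRepro.RankLevelSetLevelSixT16Cell34
import Summits.Ventures.PercRepro.RankLevelSetLevelSixT16Cell35
import Summits.Ventures.PercRepro.RankLevelSetLevelSixT16Cell36
import Summits.Ventures.PercRepro.RankLevelSetLevelSixT16Cell37
import Summits.Ventures.PercRepro.RankLevelSetLevelSixT16Cell38
import Summits.Ventures.PercRepro.RankLevelSetLevelSixT16Cell39
import Summits.Ventures.PercRepro.RankLevelSetLevelSixT16Cell40
import Summits.Ventures.PercRepro.RankLevelSetLevelSixT16Cell41
import Summits.Ventures.PercRepro.RankLevelSetLevelSixT16Cell42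
import Summits.Ventures.PercRepro.RankLevelSetLevelSixT16Cell43
import Summits.Ventures.PercRepro.RankLevelSetLevelSixT16Cell44
import Summits.Ventures.PercRepro.RankLevelSetLevelSixT16Cell45
import Summits.Ventures.PercRepro.RankLevelSetLevelSixT16Cell46
import Summits.Ventures.PercRepro.RankLevelSetLevelSixT16Cell47
import Summits.Ventures.PercRepro.RankLevelSetLevelSixT16Cell48
import Summits.Ventures.PercRepro.RankLevelSetLevelSixT16Cell49
import Summits.Ventures.PercRepro.RankLevelSetLevelSixT16Cell50
import Summits.Ventures.PercRepro.RankLevelSetLevelSixT16Cell51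
import Summits.Ventures.PercRepro.RankLevelSetLevelSixT16Cell52
import Summits.Ventures.PercRepro.RankLevelSetLevelSixT16Cell53
import Summits.Ventures.PercRepro.RankLevelSetLevelSixT16Cell54
import Summits.Ventures.PercRepro.RankLevelSetLevelSixT16Cell55
import Summits.Ventures.PercRepro.RankLevelSetLevelSixT16Cell56
import Summits.Ventures.PercRepro.RankLevelSetLevelSixT16Cell57
import Summits.Ventures.PercRepro.RankLevelSetLevelSixT16Cell58
import Summits.Ventures.PercRepro.RankLevelSetLevelSixT16Cell59
import Summits.Ventures.PercRepro.RankLevelSetLevelSixT16Cell60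
import Summits.Ventures.PercRepro.RankLevelSetLevelSixT16Cell61
import Summits.Ventures.PercRepro.RankLevelSetLevelSixT16Cell62
import Summits.Ventures.PercRepro.RankLevelSetLevelSixT16Cell63
import Summits.Ventures.PercRepro.RankLevelSetLevelSixT16Cell64
import Summits.Ventures.PercRepro.RankLevelSetLevelSixT16RegII
import Summits.Ventures.PercRepro.RankLevelSetLevelSixT17Assembly
import Summits.Ventures.PercRepro.RankLevelSetLevelFiveCqFifteen

/-!
# PercRepro — THE 16 ROW: `c025_six_large_sixteen (16 ≤ p) : RLS M p 6` — C-025 AT LEVEL `6` FOR EVERY `p ≥ 16`, EVERY FINITE MATROID (p8 g15, S3)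

The core cells `(16, d)`: `d ∈ [7, 8, 9, 10, 11, 12, 13, 14, 15, 16, 17, 18, 19, 20, 21, 22, 23, 24, 25, 26, 27, 28, 29, 30, 31, 32, 33, 34, 35, 36, 37, 38, 39, 40, 41, 42, 43, 44, 45, 46, 47, 48, 49, 50, 51, 52, 53, 54, 55, 56, 57, 58, 59, 60, 61, 62, 63, 64]` by THE COLOOP DEVICE WITH THE LP CHAIN (`c025_core_six_sixteen_d`: `k = 0` and the chain
steps the coloop-free cells of p2's nullity-split coloop/closure LP run at level `6` (`S3LP.s6lp_*`, natural or scaled), then the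
exported-count rows and the trivial rows), `` by the basis cells
(``), `d ≥ 65` by regime II (`c025_core_six_regII_basis_16`). Then the level-5 glue:
`rls_six_at_of_core 16` on p7's `c025_five_large_sharp15` (level `5` at `p = 15`) and the 17 row (`c025_six_large_seventeen`) for `p ≥ 17`.
Axioms: standard.
-/

open scoped Matroid

namespace PercRepro

namespace ThmN

variable {α : Type}

/-- **The core cell `(16, d)` at every corank `d ≥ 65`, every `e`-free core** (the basis cells and regime II). -/
theorem c025_core_six_sixteen_large (M : Matroid α) [M.Finite] (d : ℕ) (hd : 65 ≤ d)
    (hR : M.eRank = (16 : ℕ∞)) (hn : M.E.ncard = 16 + d)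
    (hfree : ∀ e ∈ M.E, ∃ A ⊆ M.E \ {e}, e ∉ M.closure A ∧ e ∉ M.closure ((M.E \ {e}) \ A)) :
    RLS M 16 6 := by
  exact c025_core_six_regII_basis_16 M d (by omega) hR hn hfree

/-- **The core cell `(16, d)` at every corank `d ≥ 7`, every `e`-free core.** -/
theorem c025_core_six_sixteen (M : Matroid α) [M.Finite] (d : ℕ) (hd7 : 7 ≤ d)
    (hR : M.eRank = (16 : ℕ∞)) (hn : M.E.ncard = 16 + d)
    (hfree : ∀ e ∈ M.E, ∃ A ⊆ M.E \ {e}, e ∉ M.closure A ∧ e ∉ M.closure ((M.E \ {e}) \ A)) :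
    RLS M 16 6 := by
  rcases Nat.lt_or_ge d 65 with hlt | hge
  · interval_cases d
    · exact c025_core_six_sixteen_7 M hR hn hfree
    · exact c025_core_six_sixteen_8 M hR hn hfree
    · exact c025_core_six_sixteen_9 M hR hn hfree
    · exact c025_core_six_sixteen_10 M hR hn hfree
    · exact c025_core_six_sixteen_11 M hR hn hfree
    · exact c025_core_six_sixteen_12 M hR hn hfree
    · exact c025_core_six_sixteen_13 M hR hn hfree
    · exact c025_core_six_sixteen_14 M hR hn hfree
    · exact c025_core_six_sixteen_15 M hR hn hfree
    · exact c025_core_six_sixteen_16 M hR hn hfree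
    · exact c025_core_six_sixteen_17 M hR hn hfree
    · exact c025_core_six_sixteen_18 M hR hn hfree
    · exact c025_core_six_sixteen_19 M hR hn hfree
    · exact c025_core_six_sixteen_20 M hR hn hfree
    · exact c025_core_six_sixteen_21 M hR hn hfree
    · exact c025_core_six_sixteen_22 M hR hn hfree
    · exact c025_core_six_sixteen_23 M hR hn hfree
    · exact c025_core_six_sixteen_24 M hR hn hfree
    · exact c025_core_six_sixteen_25 M hR hn hfree
    · exact c025_core_six_sixteen_26 M hR hn hfree
    · exact c025_core_six_sixteen_27 M hR hn hfree
    · exact c025_core_six_sixteen_28 M hR hn hfree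
    · exact c025_core_six_sixteen_29 M hR hn hfree
    · exact c025_core_six_sixteen_30 M hR hn hfree
    · exact c025_core_six_sixteen_31 M hR hn hfree
    · exact c025_core_six_sixteen_32 M hR hn hfree
    · exact c025_core_six_sixteen_33 M hR hn hfree
    · exact c025_core_six_sixteen_34 M hR hn hfree
    · exact c025_core_six_sixteen_35 M hR hn hfree
    · exact c025_core_six_sixteen_36 M hR hn hfree
    · exact c025_core_six_sixteen_37 M hR hn hfree
    · exact c025_core_six_sixteen_38 M hR hn hfree
    · exact c025_core_six_sixteen_39 M hR hn hfree
    · exact c025_core_six_sixteen_40 M hR hn hfree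
    · exact c025_core_six_sixteen_41 M hR hn hfree
    · exact c025_core_six_sixteen_42 M hR hn hfree
    · exact c025_core_six_sixteen_43 M hR hn hfree
    · exact c025_core_six_sixteen_44 M hR hn hfree
    · exact c025_core_six_sixteen_45 M hR hn hfree
    · exact c025_core_six_sixteen_46 M hR hn hfree
    · exact c025_core_six_sixteen_47 M hR hn hfree
    · exact c025_core_six_sixteen_48 M hR hn hfree
    · exact c025_core_six_sixteen_49 M hR hn hfree
    · exact c025_core_six_sixteen_50 M hR hn hfree
    · exact c025_core_six_sixteen_51 M hR hn hfree
    · exact c025_core_six_sixteen_52 M hR hn hfree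
    · exact c025_core_six_sixteen_53 M hR hn hfree
    · exact c025_core_six_sixteen_54 M hR hn hfree
    · exact c025_core_six_sixteen_55 M hR hn hfree
    · exact c025_core_six_sixteen_56 M hR hn hfree
    · exact c025_core_six_sixteen_57 M hR hn hfree
    · exact c025_core_six_sixteen_58 M hR hn hfree
    · exact c025_core_six_sixteen_59 M hR hn hfree
    · exact c025_core_six_sixteen_60 M hR hn hfree
    · exact c025_core_six_sixteen_61 M hR hn hfree
    · exact c025_core_six_sixteen_62 M hR hn hfree
    · exact c025_core_six_sixteen_63 M hR hn hfree
    · exact c025_core_six_sixteen_64 M hR hn hfree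
  · exact c025_core_six_sixteen_large M d hge hR hn hfree

/-- **THEOREM C₆ AT RANK `16`, GIVEN LEVEL `5`**: level `5` for all `p ≥ 15` implies level `6` for all `p ≥ 16`
(`p = 16` by the cells and `rls_six_at_of_core`; `p ≥ 17` by the 17 row). -/
theorem c025_six_of_five_t16
    (h5 : ∀ (M : Matroid α) [M.Finite] (p : ℕ), 15 ≤ p → RLS M p 5) :
    ∀ (M : Matroid α) [M.Finite] (p : ℕ), 16 ≤ p → RLS M p 6 := by
  intro M _ p hp
  rcases Nat.lt_or_ge p 17 with hlt | hge
  · have hP : p = 16 := by omega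
    subst hP
    refine rls_six_at_of_core 16 (by norm_num) (fun M _ => h5 M 15 (by norm_num)) ?_ M
    intro M _ d hd hR hn hfree
    exact c025_core_six_sixteen M d hd hR hn hfree
  · exact c025_six_large_seventeen M p hge

/-- **C-025 AT LEVEL `6` FOR EVERY `p ≥ 16`, EVERY FINITE MATROID** — on p7's `c025_five_large_sharp15 (15 ≤ p)`. -/
theorem c025_six_large_sixteen (M : Matroid α) [M.Finite] (p : ℕ) (hp : 16 ≤ p) : RLS M p 6 :=
  c025_six_of_five_t16 (fun M _ p hp => c025_five_large_sharp15 M p (by omega)) M p hp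

end ThmN

end PercRepro
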